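import Literature.NumberTheory.QuadraticFields.ClassNumberOneBakerInequality
import Literature.NumberTheory.QuadraticFields.PrincipalOfClassNumberOne
import Literature.NumberTheory.QuadraticFields.FundamentalDiscriminant
import HarnessLib

/-!
# Baker's fundamental inequality for the class number one problem

Topic `NumberTheory/QuadraticFields`, namespace `Literature.NumberTheory.QuadraticFields.BakerLimitFormula`.
Everything here is PROVED (theorems only, no named facts).

A. Baker, *Transcendental Number Theory* (1975), Ch. 5 §4 (p. 51 of the held copy): from the two
inequalities for `k = 21` and `k = 33`, "`|b log ε + b' log ε'| < e^{−δB}`" with `b = 35h`,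
`b' = −22h'`. In the explicit form of `baker_inequality_k` (whose main terms are
`(64/21) π√d` and `(160/33) π√d`, so that `105 · (64/21) = 320 = 66 · (160/33)`):

* `baker_fundamental_inequality` — for `K` imaginary quadratic with odd `d_K = −d < −4`, `𝓞 K`
  principal, `3, 7, 11 ∤ d`, `e^{−π√d/33} ≤ ½`: there are `h₂₁ ∈ [1, 2(21d)²]`, `h₃₃ ∈ [1, 2(33d)²]` with
  `|105 h₂₁ X₂₁ − 66 h₃₃ X₃₃| ≤ 35280 e^{−π√d/21} + 34848 e^{−π√d/33}`, `X_k = √k L(1, (·/k))`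
  (`= 2 log ε_k` by the real class number formula);
* `baker_fundamental_inequality_of_classNumber_eq_one` — the same for `d = p₀` a prime
  `≡ 3 (mod 8)`, `p₀ > 163`, with form class number `h(−p₀) = 1`
  (field of discriminant `−p₀` from `FundamentalDiscriminant`, principal by `PrincipalOfClassNumberOne`);
* `heegnerStarkPrimeThreeModEight_of_ranges` — hence `HeegnerStarkPrimeThreeModEight` follows from
  an enumeration of the range `p₀ ≤ P₀` together with the statement that the fundamental
  inequality fails for `p₀ > P₀` (which is what a lower bound for the linear form in the two
  logarithms `X₂₁, X₃₃` — Baker's Thm. 3.1, or Baker–Wüstholz — provides for `P₀` around `10^{20…500}`,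
  plus Stark's continued-fraction reduction of the medium range).

## References

* [Baker1975] A. Baker, *Transcendental Number Theory* (1975), Ch. 5 §4 (p. 51).
-/

noncomputable section

open Real Complex Module NumberField Ideal
open Literature.Barriers.RiemannHypothesis Literature.NumberTheory.QuadraticFields.Quadratic
open scoped NumberTheorySymbols

namespace Literature.NumberTheory.QuadraticFields.BakerLimitFormula

/-- `7` is prime (instance for `baker_inequality_k` at `(p, q) = (3, 7)`). [folklore] -/
instance fact_prime_seven : Fact (Nat.Prime 7) := ⟨by norm_num⟩

/-- `11` is prime (instance for `baker_inequality_k` at `(p, q) = (3, 11)`). [folklore] -/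
instance fact_prime_eleven : Fact (Nat.Prime 11) := ⟨by norm_num⟩

/-- `X_k = √k · L(1, (·/k))` (`= 2 log ε_k` for `k = 21, 33`). [cite: Baker1975, Ch. 5 §4] -/
def bakerX (k : ℕ) [NeZero k] : ℂ := (Real.sqrt k : ℂ) * (jacobiChar k).LFunction 1

/-- Unfolding lemma. [folklore] -/
theorem bakerX_def (k : ℕ) [NeZero k] : bakerX k = (Real.sqrt k : ℂ) * (jacobiChar k).LFunction 1 := rfl

section

variable {K : Type*} [Field K] [NumberField K]

/-- **Baker's fundamental inequality** for a field of class number one (Ch. 5 §4):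
`|105 h₂₁ X₂₁ − 66 h₃₃ X₃₃| ≤ 35280 e^{−π√d/21} + 34848 e^{−π√d/33}`. [cite: Baker1975, Ch. 5 §4] -/
theorem baker_fundamental_inequality (h2 : finrank ℚ K = 2) (hodd : Odd (NumberField.discr K))
    [IsPrincipalIdealRing (𝓞 K)] (b : Basis (Fin 2) ℤ (𝓞 K)) (hb : b 0 = 1) {t m : ℤ}
    (hω : b 1 * b 1 = (m : 𝓞 K) + (t : 𝓞 K) * b 1) (hD : t ^ 2 + 4 * m < -4)
    (h3 : ¬ (3 : ℤ) ∣ t ^ 2 + 4 * m) (h7 : ¬ (7 : ℤ) ∣ t ^ 2 + 4 * m) (h11 : ¬ (11 : ℤ) ∣ t ^ 2 + 4 * m)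
    (hη : Real.exp (-(Real.pi * Real.sqrt (-(t ^ 2 + 4 * m : ℤ) : ℝ) / 33)) ≤ 1 / 2) :
    ∃ h₂₁ h₃₃ : ℕ, 1 ≤ h₂₁ ∧ (h₂₁ : ℝ) ≤ 2 * (21 * (-(t ^ 2 + 4 * m : ℤ) : ℝ)) ^ 2 ∧
      1 ≤ h₃₃ ∧ (h₃₃ : ℝ) ≤ 2 * (33 * (-(t ^ 2 + 4 * m : ℤ) : ℝ)) ^ 2 ∧
      ‖(105 * h₂₁ : ℂ) * bakerX 21 - (66 * h₃₃ : ℂ) * bakerX 33‖ ≤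
        35280 * Real.exp (-(Real.pi * Real.sqrt (-(t ^ 2 + 4 * m : ℤ) : ℝ) / 21)) +
          34848 * Real.exp (-(Real.pi * Real.sqrt (-(t ^ 2 + 4 * m : ℤ) : ℝ) / 33)) := by
  set s : ℝ := Real.sqrt (-(t ^ 2 + 4 * m : ℤ) : ℝ) with hs
  have hs' : Real.sqrt (-((t : ℝ) ^ 2 + 4 * (m : ℝ))) = s := by rw [hs]; push_cast; ring_nf
  have hs0 : 0 < s := Real.sqrt_pos.mpr (by exact_mod_cast (show 0 < -(t ^ 2 + 4 * m) by linarith))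
  have hπ := Real.pi_pos
  have hη21 : Real.exp (-(Real.pi * s / (3 * 7))) ≤ 1 / 2 := by
    refine le_trans (Real.exp_le_exp.mpr ?_) hη
    rw [neg_le_neg_iff]
    exact div_le_div_of_nonneg_left (by positivity) (by norm_num) (by norm_num)
  have hη33 : Real.exp (-(Real.pi * s / (3 * 11))) ≤ 1 / 2 := by norm_num; exact hη
  obtain ⟨h₂₁, h1, hle1, hin1⟩ := baker_inequality_k h2 hodd b hb hω hD (p := 3) (q := 7)
    (by norm_num) (by norm_num) (by norm_num) (by norm_num) h3 h7 (by push_cast; rw [hs']; exact hη21)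
  obtain ⟨h₃₃, h1', hle2, hin2⟩ := baker_inequality_k h2 hodd b hb hω hD (p := 3) (q := 11)
    (by norm_num) (by norm_num) (by norm_num) (by norm_num) h3 h11 (by push_cast; rw [hs']; exact hη33)
  refine ⟨h₂₁, h₃₃, h1, ?_, h1', ?_, ?_⟩
  · convert hle1 using 2; push_cast; ring
  · convert hle2 using 2; push_cast; ring
  have e21 : bakerX 21 = (Real.sqrt (3 * 7 : ℕ) : ℂ) * (jacobiChar (3 * 7)).LFunction 1 := by
    rw [bakerX_def]
  have e33 : bakerX 33 = (Real.sqrt (3 * 11 : ℕ) : ℂ) * (jacobiChar (3 * 11)).LFunction 1 := by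
    rw [bakerX_def]
  -- name the pieces
  set A₁ : ℂ := (h₂₁ : ℂ) * (Real.sqrt (3 * 7 : ℕ) : ℂ) * (jacobiChar (3 * 7)).LFunction 1 with hA₁
  set C₁ : ℂ := (((1 - ((3 : ℝ) ^ 2)⁻¹) * (1 - ((7 : ℝ) ^ 2)⁻¹) * ((3 * 7 : ℕ) / 6) * Real.pi *
    Real.sqrt (-(t ^ 2 + 4 * m : ℤ) : ℝ) : ℝ) : ℂ) with hC₁
  set A₂ : ℂ := (h₃₃ : ℂ) * (Real.sqrt (3 * 11 : ℕ) : ℂ) * (jacobiChar (3 * 11)).LFunction 1 with hA₂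
  set C₂ : ℂ := (((1 - ((3 : ℝ) ^ 2)⁻¹) * (1 - ((11 : ℝ) ^ 2)⁻¹) * ((3 * 11 : ℕ) / 6) * Real.pi *
    Real.sqrt (-(t ^ 2 + 4 * m : ℤ) : ℝ) : ℝ) : ℂ) with hC₂
  -- the main terms cancel: `105 · c₂₁ = 66 · c₃₃` (`= 320`)
  have hcancel : (105 : ℂ) * C₁ = (66 : ℂ) * C₂ := by
    rw [hC₁, hC₂]; push_cast; ring
  have key : (105 * h₂₁ : ℂ) * bakerX 21 - (66 * h₃₃ : ℂ) * bakerX 33 =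
      105 * (A₁ - C₁) - 66 * (A₂ - C₂) := by
    rw [e21, e33, hA₁, hA₂]; linear_combination hcancel
  rw [key]
  have E1 : ‖(105 : ℂ) * (A₁ - C₁)‖ ≤ 105 * (16 * (3 * 7 : ℕ) *
      Real.exp (-(Real.pi * Real.sqrt (-(t ^ 2 + 4 * m : ℤ) : ℝ) / (3 * 7)))) := by
    rw [norm_mul, Complex.norm_ofNat]; exact mul_le_mul_of_nonneg_left hin1 (by norm_num)
  have E2 : ‖(66 : ℂ) * (A₂ - C₂)‖ ≤ 66 * (16 * (3 * 11 : ℕ) *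
      Real.exp (-(Real.pi * Real.sqrt (-(t ^ 2 + 4 * m : ℤ) : ℝ) / (3 * 11)))) := by
    rw [norm_mul, Complex.norm_ofNat]; exact mul_le_mul_of_nonneg_left hin2 (by norm_num)
  refine le_trans (norm_sub_le _ _) (le_trans (add_le_add E1 E2) (le_of_eq ?_))
  have e : Real.sqrt (-(4 * (m : ℝ)) + -(t : ℝ) ^ 2) = s := by rw [← hs']; ring_nf
  norm_num
  rw [e]; ring

end

/-! ## From a prime `p₀ ≡ 3 (mod 8)` with `h(−p₀) = 1` -/

/-- **The fundamental inequality for `h(−p₀) = 1`**: for a prime `p₀ ≡ 3 (mod 8)`, `p₀ > 163`, with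
form class number `h(−p₀) = 1`, there are `h₂₁ ∈ [1, 2(21p₀)²]`, `h₃₃ ∈ [1, 2(33p₀)²]` with
`|105 h₂₁ X₂₁ − 66 h₃₃ X₃₃| ≤ 35280 e^{−π√p₀/21} + 34848 e^{−π√p₀/33}`. [cite: Baker1975, Ch. 5 §4] -/
theorem baker_fundamental_inequality_of_classNumber_eq_one {p₀ : ℕ} (hp : p₀.Prime)
    (h8 : p₀ % 8 = 3) (hgt : 163 < p₀)
    (h1 : BinaryQuadraticForm.classNumber (-(p₀ : ℤ)) = 1) :
    ∃ h₂₁ h₃₃ : ℕ, 1 ≤ h₂₁ ∧ (h₂₁ : ℝ) ≤ 2 * (21 * (p₀ : ℝ)) ^ 2 ∧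
      1 ≤ h₃₃ ∧ (h₃₃ : ℝ) ≤ 2 * (33 * (p₀ : ℝ)) ^ 2 ∧
      ‖(105 * h₂₁ : ℂ) * bakerX 21 - (66 * h₃₃ : ℂ) * bakerX 33‖ ≤
        35280 * Real.exp (-(Real.pi * Real.sqrt p₀ / 21)) +
          34848 * Real.exp (-(Real.pi * Real.sqrt p₀ / 33)) := by
  -- the field of discriminant `-p₀`
  have hfund : ((-(p₀ : ℤ)) % 4 = 1 ∧ Squarefree (-(p₀ : ℤ)) ∧ (-(p₀ : ℤ)) ≠ 1) ∨
      (4 ∣ (-(p₀ : ℤ)) ∧ ((-(p₀ : ℤ)) / 4 % 4 = 2 ∨ (-(p₀ : ℤ)) / 4 % 4 = 3) ∧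
        Squarefree ((-(p₀ : ℤ)) / 4)) :=
    Or.inl ⟨by omega, by rw [← Int.squarefree_natAbs]; simpa using hp.squarefree, by omega⟩
  obtain ⟨K, _, _, h2, hd⟩ := exists_numberField_discr_eq hfund
  obtain ⟨b, hb⟩ := exists_basis_zero_eq_one (K := K) h2
  set t := b.repr (b 1 * b 1) 1
  set m := b.repr (b 1 * b 1) 0
  have hω := basis_one_mul_self_eq b hb
  have hdisc := discr_eq_sq_add_four_mul b hb
  have htm : t ^ 2 + 4 * m = -(p₀ : ℤ) := by rw [← hdisc, hd]
  have hD : t ^ 2 + 4 * m < -4 := by rw [htm]; omega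
  have hodd : Odd (NumberField.discr K) := by rw [hd, Int.odd_iff]; omega
  haveI : IsPrincipalIdealRing (𝓞 K) :=
    isPrincipalIdealRing_of_classNumber_eq_one b hb hω (by linarith) (by rw [htm]; exact h1)
  have hnd : ∀ r : ℕ, r.Prime → r < p₀ → ¬ (r : ℤ) ∣ t ^ 2 + 4 * m := by
    intro r hr hrp hdvd
    rw [htm, dvd_neg] at hdvd
    have : r ∣ p₀ := Int.natCast_dvd_natCast.mp hdvd
    rcases (Nat.dvd_prime hp).mp this with h | h
    · exact hr.one_lt.ne' h
    · omega
  have hs : Real.sqrt (-(t ^ 2 + 4 * m : ℤ) : ℝ) = Real.sqrt p₀ := by rw [htm]; push_cast; ring_nf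
  -- `e^{-π√p₀/33} ≤ 1/2` for `p₀ ≥ 64`
  have hη : Real.exp (-(Real.pi * Real.sqrt p₀ / 33)) ≤ 1 / 2 := by
    have h8' : (8 : ℝ) ≤ Real.sqrt p₀ := by
      rw [show (8 : ℝ) = Real.sqrt 64 by rw [show (64 : ℝ) = 8 ^ 2 by norm_num, Real.sqrt_sq (by norm_num)]]
      exact Real.sqrt_le_sqrt (by exact_mod_cast (by omega : 64 ≤ p₀))
    have hlog : Real.log 2 < Real.pi * Real.sqrt p₀ / 33 := by
      have := Real.log_two_lt_d9; have := Real.pi_gt_three; nlinarith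
    rw [← Real.exp_log (by norm_num : (0 : ℝ) < 1 / 2), Real.exp_le_exp, Real.log_div (by norm_num)
      (by norm_num), Real.log_one, zero_sub]
    linarith
  obtain ⟨h₂₁, h₃₃, ha, hb', hc, hd', he⟩ := baker_fundamental_inequality h2 hodd b hb hω hD
    (hnd 3 (by norm_num) (by omega)) (hnd 7 (by norm_num) (by omega)) (hnd 11 (by norm_num) (by omega))
    (by rw [hs]; exact hη)
  refine ⟨h₂₁, h₃₃, ha, ?_, hc, ?_, ?_⟩
  · rw [htm] at hb'; push_cast at hb'; simpa using hb'
  · rw [htm] at hd'; push_cast at hd'; simpa using hd'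
  · rw [hs] at he; exact he

/-- **`HeegnerStarkPrimeThreeModEight` from the two ranges**: an enumeration of the small range
`p₀ ≤ P₀` and the failure of Baker's fundamental inequality in the large range `p₀ > P₀ ≥ 163` —
the latter being the content of a lower bound for the linear form `105 h₂₁ X₂₁ − 66 h₃₃ X₃₃` in the
two logarithms `X₂₁ = 2 log ε₂₁`, `X₃₃ = 2 log ε₃₃` (Baker's Thm. 3.1 / Baker–Wüstholz) together with
the reduction of the medium range. [cite: Baker1975, Ch. 5 §§4–5] -/
theorem heegnerStarkPrimeThreeModEight_of_ranges (P₀ : ℕ) (hP : 163 ≤ P₀)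
    (small : ∀ p₀ : ℕ, p₀.Prime → p₀ % 8 = 3 → p₀ ≤ P₀ →
      BinaryQuadraticForm.classNumber (-(p₀ : ℤ)) = 1 → p₀ ∈ ({3, 11, 19, 43, 67, 163} : Finset ℕ))
    (large : ∀ p₀ : ℕ, p₀.Prime → p₀ % 8 = 3 → P₀ < p₀ → ∀ h₂₁ h₃₃ : ℕ,
      1 ≤ h₂₁ → (h₂₁ : ℝ) ≤ 2 * (21 * (p₀ : ℝ)) ^ 2 → 1 ≤ h₃₃ → (h₃₃ : ℝ) ≤ 2 * (33 * (p₀ : ℝ)) ^ 2 →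
      35280 * Real.exp (-(Real.pi * Real.sqrt p₀ / 21)) + 34848 * Real.exp (-(Real.pi * Real.sqrt p₀ / 33)) <
        ‖(105 * h₂₁ : ℂ) * bakerX 21 - (66 * h₃₃ : ℂ) * bakerX 33‖) :
    BinaryQuadraticForm.HeegnerStarkPrimeThreeModEight := by
  intro p₀ hp h8 h1
  by_cases hle : p₀ ≤ P₀
  · exact small p₀ hp h8 hle h1
  · exfalso
    push Not at hle
    obtain ⟨h₂₁, h₃₃, ha, hb, hc, hd, he⟩ :=
      baker_fundamental_inequality_of_classNumber_eq_one hp h8 (by omega) h1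
    exact absurd he (not_le.mpr (large p₀ hp h8 hle h₂₁ h₃₃ ha hb hc hd))

end Literature.NumberTheory.QuadraticFields.BakerLimitFormula
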